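import Literature.MathematicalPhysics.QuantumFieldTheory.Balaban1983to89.Node00.OpsYRead342Pair
import Summits.QuantumFields.YangMills.Theorems.BalabanUVNodesRateCarriersOfRecord11
import HarnessLib

/-!
# Route «BalabanUVNodes», cluster K4 «SpineRates» — node N15 = NE2, -a lane (dag-n15-a g22, file R-K): N15's `NE2Objects₁₁` AT THE RECORD — THE OPERATOR LAYER READ BY
# NODE 00's TWO-MEMBER (3.42) DIFFERENCE READER `kernelFamilyS₂Y` (def-Y (R-ii), p625329) OVER KING's PAIRING `pairedInstanceY` OF A MEMBER WITH ITS n-FOLD REFINEMENT;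
# the `N15At` face DISPLAYS N15's estimate; the γ = 0 floor is Thm 3.1 twice (def-Y's face, cited)

Cell `pub-ymgap`, seat `pub-ymgap-dag-n15-a` (KNIT-BY-NAME; HUMAN RULING D-0062; chair R424 venue), generation 22.  `bears_on: R4∕N15 · K3⁷ SpineGivenEndpointR13SepCoPH
(stmt-QuantumFields-20544)`.  Filed `--kind proof --supports stmt-QuantumFields-20544 --as helper` — COUNT-NEUTRAL.  ONE data `def` (an `NE2Objects₁₁` literal), the rest `rfl`∕`Iff`
faces; 0 `sorry`.  Imports def-Y's `Node00.OpsYRead342Pair` ((R-i)∕(R-ii): `refineY`, `pairingY`, `pairedInstanceY`, `kernelFamilyS₂Y`, `etaRateIneq342_zero_kernelFamilyS₂Y`) and RR-1's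
`…RateCarriersOfRecord11` (`Node00.NE2Objects₁₁`, `ne2OfRecord₁₁`, `N15At`); nothing in the tree is modified.  PATTERN = S-B `…N15FullPropagatorSizedRecord` (`fullGSizedObjects`, the U ≡ 1 MODEL
pin) — here with NODE 00's GENUINE operator-layer objects.

WHY (trigger (t5) of `HOME/HANDOFF-dag-n15-a.md` §g19.2 LOCATED-R).  N15's η-rate statement `T4EtaRate.NE2PlusOperator` quantifies over a family of `PairedInstance`s and `B9.KernelFamily`s.
Until def-Y's g19∕g21 files the tree had NO genuine two-member object of record to quantify over (every `NE2Objects₁₁` literal so far — `fullGCovObjects`, `fullGSizedObjects`, `c2Objects`,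
… — is a `U ≡ 1` MODEL).  def-Y typed King's pairing of a member `x : MemberY …` with its n-fold refinement `x⁺ = refineY x n` (`pairingY`, transports `ι, τ` genuine, the background
transport `avg` a PARAMETER) and the two-member (3.42) difference reader `kernelFamilyS₂Y` over Node 00's site letters (record default `GpY _ (parSymY _)` = Bałaban's `G′(U) = Δ′_a(U)⁻¹`
(3.24) at both members).  THIS FILE assembles them into N15's RR-1 container BY NAME, so that the plan can pin `(𝔯.lit …).ne2` AT THE RECORD with the N15 estimate DISPLAYED — an
OPEN hypothesis about Bałaban's own propagators (NE2⁺ is NOT PRINTED), not a junk-closable slot.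

WHAT.  §1 def `ne2ObjectsOfRecordY` — over ANY index family `x : I → MemberY …`, refinement depths `n : I → ℕ`, background transports `avg i` (`avg 1 = 1`), site letters `Of i ∕ Oc i`
at the fine ∕ coarse member, and — PARAMETERS, honestly — the site ∕ unit kernels `Ksite ∕ Kunit`, region `inΛ` and unit distance `unitDist` (no two-member SITE∕UNIT difference reader of
record exists yet; the unit layer's middle factor `C̃^{(k)}` is RESIDUAL per `OpsYRecordV5`): `pi i := pairedInstanceY 𝔸 G (x i) (n i) (avg i) (havg i)`, `Kop i := kernelFamilyS₂Y G (x i)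
(n i) (avg i) (Of i) (Oc i)`; `ne2OfRecord₁₁_ne2ObjectsOfRecordY` (rfl); `populated_ne2ObjectsOfRecordY_iff`.  §2 ★★ `n15At_ne2ObjectsOfRecordY_iff` — `N15At` AT THE RECORD LITERAL IS,
BY `Iff.rfl`, `NE2PlusOperator c₃₅ (pairedInstanceY-family) (kernelFamilyS₂Y-family) ∧ NE2PlusSite 4 p … Ksite ∧ NE2PlusUnit … Kunit inΛ unitDist` — the operator conjunct is N15's
estimate for Bałaban's `G(U)` pair read through King's pairing (γ > 0: King Prop. 3.9's gain — NOT PRINTED for the non-abelian background, NOT proved); ★ `n15At_ne2ObjectsOfRecordY_of`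
(the three layers ⟹ `N15At`: the socket the K3⁷ pin reads, `h15` displayed); `ne2PlusOperator_recordY_mono_c35`-free remark: the γ = 0 FLOOR — (3.42) at the fine member + (3.42) at the
coarse member ⟹ `EtaRateIneq342 (Kop i) (B₁ + B₂) δ 0 U′` — is def-Y's `etaRateIneq342_zero_kernelFamilyS₂Y` BY NAME (cited, not restated); it is NOT `NE2PlusOperator` (which demands
`0 < γ`).

HONEST FRAMING.  Bookkeeping over def-Y's OBJECTS; no estimate in this file.  The record literal's `N15At` is DISPLAYED wherever used (hypothesis-form); the site∕unit slots are
parameters (located: no genuine two-member site∕unit readers yet); Bałaban's n-fold average `avg` is a parameter (RR-1's datum), not constructed; nothing of [B9] Thm 3.1∕3.2∕3.14∕3.15 or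
King Prop. 3.9 asserted; **N15 NOT discharged** (NE2⁺ at a (3.35)-regular `U` NOT PRINTED); counts of record UNMOVED (typed 28∕28 · discharged 5∕27); one finite 𝕋⁴ programme at fixed
`ε` — NOT ℝ⁴, NOT infinite volume, NOT OS, NOT a mass gap, NOT Clay.  Restate-immune (no Theses import).
-/

set_option autoImplicit false

noncomputable section

namespace Summit.QuantumFields.YangMills.BalabanUVNodes.N15.GenuineRecord

open Literature.MathematicalPhysics.QuantumFieldTheory.Balaban1983to89
open Literature.MathematicalPhysics.QuantumFieldTheory.Balaban1983to89.T4EtaRate (PairedInstance NE2PlusOperator NE2PlusSite NE2PlusUnit EtaRateIneq342)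
open Literature.MathematicalPhysics.QuantumFieldTheory.Balaban1983to89.B9PinMembersKLevelV1 (MemberY geo9Y bg9Y)
open Literature.MathematicalPhysics.QuantumFieldTheory.Balaban1983to89.Node00 (NE2Objects₁₁ CfgY SiteOpY)
open Literature.MathematicalPhysics.QuantumFieldTheory.Balaban1983to89.Node00.MemberYRefine (refineY)
open Literature.MathematicalPhysics.QuantumFieldTheory.Balaban1983to89.Node00.OpsYRead342Pair (pairingY pairedInstanceY kernelFamilyS₂Y)
open YMDAG.UVSplit (NE2Carriers N15At ne2OfRecord₁₁)

variable {d ℓ : ℕ} {hd : 1 ≤ d + 1} {hL : Odd (ℓ + 1) ∧ 1 < ℓ + 1} {b₀ b₁ : ℝ} {Mstar : ℕ}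
variable {𝔸 : Type} [NormedRing 𝔸] [NormedAlgebra ℂ 𝔸] [CompleteSpace 𝔸]

/-! ## §1 N15's `NE2Objects₁₁` at the record: the operator layer by `kernelFamilyS₂Y` over `pairedInstanceY` -/

section Literal

variable (G : Subgroup 𝔸ˣ) {I : Type} (x : I → MemberY d ℓ hd hL b₀ b₁ Mstar) (n : I → ℕ)
  (avg : ∀ i, CfgY 𝔸 (refineY (x i) (n i)).toKIdx → CfgY 𝔸 (x i).toKIdx)
  (havg : ∀ i, avg i (bg9Y 𝔸 G (refineY (x i) (n i))).one = (bg9Y 𝔸 G (x i)).one)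
  (Of : ∀ i, SiteOpY 𝔸 (refineY (x i) (n i)).toKIdx) (Oc : ∀ i, SiteOpY 𝔸 (x i).toKIdx)
  (Ksite Kunit : ∀ i, B9.SiteKernel (geo9Y (x i)) (bg9Y 𝔸 G (refineY (x i) (n i))))
  (inΛ : ∀ i, (geo9Y (x i)).Site → Prop) (unitDist : ∀ i, (geo9Y (x i)).Site → (geo9Y (x i)).Site → ℝ) (c35 p : ℝ)

/-- **N15's NE2 OBJECTS AT THE RECORD — THE OPERATOR LAYER GENUINE** (RR-1's layer-A container `Node00.NE2Objects₁₁`): index family of members `x i` of record with refinement depths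
`n i` («run A at η, run B at η′ = L^{−n}η»), the paired instances `pairedInstanceY` (King's pairing `pairingY`: `ι, τ` genuine, `avg i` a PARAMETER with `avg 1 = 1`), the OPERATOR
kernels = def-Y's two-member (3.42) difference reader `kernelFamilyS₂Y` over the site letters `Of i ∕ Oc i` (record default: Bałaban's `G′(U) = Δ′_a(U)⁻¹` at both members); the SITE ∕
UNIT kernels, region and unit distance are PARAMETERS — to be instantiated BY NAME with def-Y's two-member site ∕ unit difference readers `siteKernelS₂Y` ∕ `unitKernelS₂Y`
(`Node00/OpsYSiteKernelPair`, INTENT-44): genuine READERS; the record's unit LETTER `C̃^{(k)}` stays the residual middle factor of `OpsYRecordV5` («genuine reader of a residual letter»). [cite: King1986, p.664 (pairing convention), Prop. 3.9 (3.73) p.665 (objects only);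
Balaban1985BackgroundPropagators, (3.42) p.397, Thm 3.14 pp.426–427 (typing template)] -/
def ne2ObjectsOfRecordY : NE2Objects₁₁ where
  I := I
  c35 := c35
  p := p
  pi := fun i => pairedInstanceY 𝔸 G (x i) (n i) (avg i) (havg i)
  Kop := fun i => kernelFamilyS₂Y G (x i) (n i) (avg i) (Of i) (Oc i)
  Ksite := Ksite
  Kunit := Kunit
  inΛ := inΛ
  unitDist := unitDist

/-- The home's NE2 bundle of the record objects, field for field (`rfl`). [bookkeeping] -/
theorem ne2OfRecord₁₁_ne2ObjectsOfRecordY :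
    ne2OfRecord₁₁ (ne2ObjectsOfRecordY G x n avg havg Of Oc Ksite Kunit inΛ unitDist c35 p) =
      { I := I, c35 := c35, p := p, pi := fun i => pairedInstanceY 𝔸 G (x i) (n i) (avg i) (havg i),
        Kop := fun i => kernelFamilyS₂Y G (x i) (n i) (avg i) (Of i) (Oc i), Ksite := Ksite, Kunit := Kunit, inΛ := inΛ, unitDist := unitDist } := rfl

/-- the paired instance of the record objects at index `i` IS def-Y's `pairedInstanceY` (rfl). [bookkeeping] -/
theorem pi_ne2ObjectsOfRecordY (i : I) :
    (ne2ObjectsOfRecordY G x n avg havg Of Oc Ksite Kunit inΛ unitDist c35 p).pi i = pairedInstanceY 𝔸 G (x i) (n i) (avg i) (havg i) := rfl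

/-- the operator kernel of the record objects at index `i` IS def-Y's `kernelFamilyS₂Y` (rfl). [bookkeeping] -/
theorem kop_ne2ObjectsOfRecordY (i : I) :
    (ne2ObjectsOfRecordY G x n avg havg Of Oc Ksite Kunit inΛ unitDist c35 p).Kop i = kernelFamilyS₂Y G (x i) (n i) (avg i) (Of i) (Oc i) := rfl

/-- RR-1's display at the record literal: `Populated` iff the index family is inhabited. [bookkeeping] -/
theorem populated_ne2ObjectsOfRecordY_iff :
    (ne2ObjectsOfRecordY G x n avg havg Of Oc Ksite Kunit inΛ unitDist c35 p).Populated ↔ Nonempty I := Iff.rfl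

end Literal

/-! ## §2 `N15At` at the record literal: the displayed N15 estimate, named -/

section Faces

variable (G : Subgroup 𝔸ˣ) {I : Type} (x : I → MemberY d ℓ hd hL b₀ b₁ Mstar) (n : I → ℕ)
  (avg : ∀ i, CfgY 𝔸 (refineY (x i) (n i)).toKIdx → CfgY 𝔸 (x i).toKIdx)
  (havg : ∀ i, avg i (bg9Y 𝔸 G (refineY (x i) (n i))).one = (bg9Y 𝔸 G (x i)).one)
  (Of : ∀ i, SiteOpY 𝔸 (refineY (x i) (n i)).toKIdx) (Oc : ∀ i, SiteOpY 𝔸 (x i).toKIdx)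
  (Ksite Kunit : ∀ i, B9.SiteKernel (geo9Y (x i)) (bg9Y 𝔸 G (refineY (x i) (n i))))
  (inΛ : ∀ i, (geo9Y (x i)).Site → Prop) (unitDist : ∀ i, (geo9Y (x i)).Site → (geo9Y (x i)).Site → ℝ) (c35 p : ℝ)

/-- ★★ **`N15At` AT THE RECORD LITERAL, UNFOLDED (`Iff.rfl`)**: the node's conjunction at the genuine operator layer is `NE2PlusOperator c₃₅ (pairedInstanceY …) (kernelFamilyS₂Y …)` —
N15's η-rate estimate for Bałaban's propagator pair `(G′(U′), G(avg U′))` read through King's pairing, with a rate exponent `γ > 0` — together with the site and unit layers at the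
supplied kernels.  This is the hypothesis the K3⁷ pin of N15 at the record DISPLAYS; it is NOT printed ([B9] proves (3.42) at ONE spacing; King Prop. 3.9 is the abelian scalar template)
and NOT proved here. [cite: Balaban1985BackgroundPropagators, Thm 3.1 (3.42) p.397, Thm 3.14 pp.426–427; King1986, Prop. 3.9 (3.73) p.665] -/
theorem n15At_ne2ObjectsOfRecordY_iff :
    N15At (ne2OfRecord₁₁ (ne2ObjectsOfRecordY G x n avg havg Of Oc Ksite Kunit inΛ unitDist c35 p)) ↔
      NE2PlusOperator c35 (fun i => pairedInstanceY 𝔸 G (x i) (n i) (avg i) (havg i)) (fun i => kernelFamilyS₂Y G (x i) (n i) (avg i) (Of i) (Oc i)) ∧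
        NE2PlusSite 4 p c35 (fun i => pairedInstanceY 𝔸 G (x i) (n i) (avg i) (havg i)) Ksite ∧
        NE2PlusUnit c35 (fun i => pairedInstanceY 𝔸 G (x i) (n i) (avg i) (havg i)) Kunit inΛ unitDist :=
  Iff.rfl

/-- ★ **THE SOCKET**: the three layer estimates at the record objects ⟹ `N15At` at their bundle (what a K3⁷ pin of N15 AT THE RECORD reads, `h15` = the operator conjunct displayed).
[cite: Balaban1985BackgroundPropagators, Thm 3.14 pp.426–427 (template); King1986, Prop. 3.9 (3.73) p.665] -/
theorem n15At_ne2ObjectsOfRecordY_of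
    (hop : NE2PlusOperator c35 (fun i => pairedInstanceY 𝔸 G (x i) (n i) (avg i) (havg i)) (fun i => kernelFamilyS₂Y G (x i) (n i) (avg i) (Of i) (Oc i)))
    (hsite : NE2PlusSite 4 p c35 (fun i => pairedInstanceY 𝔸 G (x i) (n i) (avg i) (havg i)) Ksite)
    (hunit : NE2PlusUnit c35 (fun i => pairedInstanceY 𝔸 G (x i) (n i) (avg i) (havg i)) Kunit inΛ unitDist) :
    N15At (ne2OfRecord₁₁ (ne2ObjectsOfRecordY G x n avg havg Of Oc Ksite Kunit inΛ unitDist c35 p)) :=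
  ⟨hop, hsite, hunit⟩

/-- conversely, the operator-layer estimate is READ OFF `N15At` at the record literal. [bookkeeping] -/
theorem ne2PlusOperator_of_n15At_ne2ObjectsOfRecordY
    (h : N15At (ne2OfRecord₁₁ (ne2ObjectsOfRecordY G x n avg havg Of Oc Ksite Kunit inΛ unitDist c35 p))) :
    NE2PlusOperator c35 (fun i => pairedInstanceY 𝔸 G (x i) (n i) (avg i) (havg i)) (fun i => kernelFamilyS₂Y G (x i) (n i) (avg i) (Of i) (Oc i)) :=
  h.1

/-- **THE GUARD IS LIVE AT THE RECORD**: the [B9] size parameter the operator layer's guard `M₅ ≤ gf.M` reads at index `i` is the FINE member's own `(geo9Y (x i)⁺).M` (rfl) — no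
`M ≡ 1` vacuity. [cite: Balaban1985BackgroundPropagators, Thm 3.1 p.397 («for M ≥ M₁»)] -/
theorem gfM_ne2ObjectsOfRecordY (i : I) :
    ((ne2ObjectsOfRecordY G x n avg havg Of Oc Ksite Kunit inΛ unitDist c35 p).pi i).gf.M = (geo9Y (refineY (x i) (n i))).M := rfl

end Faces

end Summit.QuantumFields.YangMills.BalabanUVNodes.N15.GenuineRecord

end
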